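import Summits.AtomisticToContinuum.Crystallization.Theses.PricedLinkCensus

/-!
# Defect-far-site locality: the near₂ (elastic-basin) predicate of a site only sees the sites within `3.57` of it

Helper (FAR₂-LOCALITY) for the stub `stub_defectFarSiteGap` (FAR₂, the open core) of the line
`elastic-basin-split` (`Cruxes/TruncatedCensusGap/Lines/elastic_basin_split.lean`) of the crux
`PricedLinkCensus.TruncatedCensusGap` (item stmt-AtomisticToContinuum-14230).  It is the PORT
to the near₂ predicate of the landed FAR-LOCALITY `nearBarlow_apply_iff_comp`
(`…TruncatedCensusGapFarLocality.lean`, line `near-far-split`), itself the analogue of the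
CHARGE LOCALITY `isChargeFree_sub_iff` and UNDER-COORDINATION LOCALITY `underCoordinated_sub_iff`.

The line cuts the sites of a finite configuration `y : Fin N → ℝ³` by the GEOMETRY of their
closed `3a₀`-patch (`a₀ = 977/1000`, `3a₀ = 2931/1000`): the site `i` is **near₂** (in the
elastic basin) when for some Hägg word `s`, some linear strain `F : ℝ³ →L[ℝ] ℝ³` within `10 %`
of `a₀ • id` (`‖F v - a₀ • v‖ ≤ (a₀/10) ‖v‖`) and some rigid motion `g : ℝ³ ≃ᵃⁱ[ℝ] ℝ³`

* (separation) every site within `3a₀` of `y i` has all other sites at distance `≥ a₀/2 = 977/2000`,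
* (sites → stacking) every site within `3a₀` of `y i` is within `a₀/8 = 977/8000` of a reference
  point `g (F z)`, `z ∈ barlowStacking 1 √(2/3) s` (the ideal stacking, strained then moved),
* (stacking → sites) every reference point `g (F z)` within `3a₀` of `y i` is within `a₀/8` of
  a site;

this is the long predicate `∃ s F g, …` inlined in the stub, whose complement (the DEFECT-FAR
sites) is counted by `Nat.card {i // ¬ ∃ s F g, …}`.  No definition is introduced here: every
statement spells the predicate out, for a configuration `y : ι → ℝ³` on an arbitrary index type
(so that it can be read on `Fin N`, on the points `Q.points` of a periodic configuration via
`Subtype.val`, and on block index types).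

**Theorem (`nearBasin_apply_iff_comp`).**  For `y : ι → ℝ³` and an injective re-indexing
`f : κ → ι` whose range contains every site within `357/100` of `y (f i)`, the site `f i` is
near₂ in `y` iff `i` is near₂ in the sub-configuration `y ∘ f` (same word, strain and motion).
Indeed the three clauses only involve sites within `2931/1000 + 977/2000 = 3.4195 ≤ 357/100`
of `y (f i)` (separation: a site closer than `a₀/2` to a patch site is within `7a₀/2` of the
centre; the matching witnesses lie within `2931/1000 + 977/8000 = 3.053125`).  The radius
`357/100` is that of the template, so all downstream constants (block depth `4`, far
periodisation period `8D + 8`) are unchanged.  `Fin`-indexed forms (`f : Fin M ↪ Fin N`):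
`nearBasin_sub_iff`, `dfar_sub_iff`.  Also: invariance under re-indexing by an equivalence
(`nearBasin_comp_equiv_iff`) and under rigid motions / translations of the whole configuration
(`nearBasin_isometry_comp_iff`, `nearBasin_add_const_comp_iff`: compose the chart `g` with the
motion, keep `s` and `F`).

Margin ledger: locality needs `3.4195 ≤ 3.57` and `3.053125 ≤ 3.57` (slack `0.15`, `0.52`).
All `[folklore]` bookkeeping; the content of (FAR₂) is untouched.
-/

noncomputable section

namespace Summit.AtomisticToContinuum.Crystallization.Theorems.PricedLinkCensusTruncatedCensusGap

open Literature.MathematicalPhysics.StatisticalMechanics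

section General

variable {ι κ : Type*}

/-- **Re-indexing invariance.**  Relabelling the sites by an equivalence `e : κ ≃ ι` does not
change the near₂ predicate: `i` is near₂ in `y ∘ e` iff `e i` is near₂ in `y` (same word,
strain and motion). [folklore] -/
theorem nearBasin_comp_equiv_iff (y : ι → EuclideanSpace ℝ (Fin 3)) (e : κ ≃ ι) (i : κ) :
    (∃ (s : ℤ → ℤ) (F : EuclideanSpace ℝ (Fin 3) →L[ℝ] EuclideanSpace ℝ (Fin 3)) (g : EuclideanSpace ℝ (Fin 3) ≃ᵃⁱ[ℝ] EuclideanSpace ℝ (Fin 3)), Literature.MathematicalPhysics.StatisticalMechanics.IsHaggSeq s ∧ (∀ v : EuclideanSpace ℝ (Fin 3), ‖F v - (977 / 1000 : ℝ) • v‖ ≤ 977 / 10000 * ‖v‖) ∧ (∀ j k, j ≠ k → dist ((y ∘ ⇑e) j) ((y ∘ ⇑e) i) ≤ 2931 / 1000 → 977 / 2000 ≤ dist ((y ∘ ⇑e) j) ((y ∘ ⇑e) k)) ∧ (∀ j, dist ((y ∘ ⇑e) j) ((y ∘ ⇑e) i) ≤ 2931 / 1000 → ∃ z ∈ Literature.MathematicalPhysics.StatisticalMechanics.barlowStacking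 1 (Real.sqrt (2 / 3)) s, dist ((y ∘ ⇑e) j) (g (F z)) ≤ 977 / 8000) ∧ (∀ z ∈ Literature.MathematicalPhysics.StatisticalMechanics.barlowStacking 1 (Real.sqrt (2 / 3)) s, dist (g (F z)) ((y ∘ ⇑e) i) ≤ 2931 / 1000 → ∃ j, dist ((y ∘ ⇑e) j) (g (F z)) ≤ 977 / 8000)) ↔
      (∃ (s : ℤ → ℤ) (F : EuclideanSpace ℝ (Fin 3) →L[ℝ] EuclideanSpace ℝ (Fin 3)) (g : EuclideanSpace ℝ (Fin 3) ≃ᵃⁱ[ℝ] EuclideanSpace ℝ (Fin 3)), Literature.MathematicalPhysics.StatisticalMechanics.IsHaggSeq s ∧ (∀ v : EuclideanSpace ℝ (Fin 3), ‖F v - (977 / 1000 : ℝ) • v‖ ≤ 977 / 10000 * ‖v‖) ∧ (∀ j k, j ≠ k → dist (y j) (y (e i)) ≤ 2931 / 1000 → 977 / 2000 ≤ dist (y j) (y k)) ∧ (∀ j, dist (y j) (y (e i)) ≤ 2931 / 1000 → ∃ z ∈ Literature.MathematicalPhysics.StatisticalMechanics.barlowStacking 1 (Real.sqrt (2 / 3))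 s, dist (y j) (g (F z)) ≤ 977 / 8000) ∧ (∀ z ∈ Literature.MathematicalPhysics.StatisticalMechanics.barlowStacking 1 (Real.sqrt (2 / 3)) s, dist (g (F z)) (y (e i)) ≤ 2931 / 1000 → ∃ j, dist (y j) (g (F z)) ≤ 977 / 8000)) := by
  constructor
  · rintro ⟨s, F, g, hs, hF, hsep, hm1, hm2⟩
    refine ⟨s, F, g, hs, hF, ?_, ?_, ?_⟩
    · intro j k hjk hj
      simpa using hsep (e.symm j) (e.symm k) (by simpa using hjk) (by simpa using hj)
    · intro j hj
      simpa using hm1 (e.symm j) (by simpa using hj)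
    · intro z hz hzi
      obtain ⟨j, hj⟩ := hm2 z hz (by simpa using hzi)
      exact ⟨e j, by simpa using hj⟩
  · rintro ⟨s, F, g, hs, hF, hsep, hm1, hm2⟩
    refine ⟨s, F, g, hs, hF, ?_, ?_, ?_⟩
    · intro j k hjk hj
      simpa using hsep (e j) (e k) (by simpa using hjk) (by simpa using hj)
    · intro j hj
      simpa using hm1 (e j) (by simpa using hj)
    · intro z hz hzi
      obtain ⟨j, hj⟩ := hm2 z hz (by simpa using hzi)
      exact ⟨e.symm j, by simpa using hj⟩

/-- Moving the whole configuration by a rigid motion `φ` keeps near₂ sites near₂ (compose the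
chart `g` with `φ`; the word `s` and the strain `F` are kept). [folklore] -/
theorem nearBasin_isometry_comp_of (φ : EuclideanSpace ℝ (Fin 3) ≃ᵃⁱ[ℝ] EuclideanSpace ℝ (Fin 3)) (y : ι → EuclideanSpace ℝ (Fin 3)) (i : ι)
    (h : ∃ (s : ℤ → ℤ) (F : EuclideanSpace ℝ (Fin 3) →L[ℝ] EuclideanSpace ℝ (Fin 3)) (g : EuclideanSpace ℝ (Fin 3) ≃ᵃⁱ[ℝ] EuclideanSpace ℝ (Fin 3)), Literature.MathematicalPhysics.StatisticalMechanics.IsHaggSeq s ∧ (∀ v : EuclideanSpace ℝ (Fin 3), ‖F v - (977 / 1000 : ℝ) • v‖ ≤ 977 / 10000 * ‖v‖) ∧ (∀ j k, j ≠ k → dist (y j) (y i) ≤ 2931 / 1000 → 977 / 2000 ≤ dist (y j) (y k)) ∧ (∀ j, dist (y j) (y i) ≤ 2931 / 1000 → ∃ z ∈ Literature.MathematicalPhysics.StatisticalMechanics.barlowStacking 1 (Real.sqrt (2 / 3)) s, dist (y j) (g (F z)) ≤ 977 / 8000) ∧ (∀ z ∈ Literature.MathematicalPhysics.StatisticalMechanics.barlowStacking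 1 (Real.sqrt (2 / 3)) s, dist (g (F z)) (y i) ≤ 2931 / 1000 → ∃ j, dist (y j) (g (F z)) ≤ 977 / 8000)) :
    ∃ (s : ℤ → ℤ) (F : EuclideanSpace ℝ (Fin 3) →L[ℝ] EuclideanSpace ℝ (Fin 3)) (g : EuclideanSpace ℝ (Fin 3) ≃ᵃⁱ[ℝ] EuclideanSpace ℝ (Fin 3)), Literature.MathematicalPhysics.StatisticalMechanics.IsHaggSeq s ∧ (∀ v : EuclideanSpace ℝ (Fin 3), ‖F v - (977 / 1000 : ℝ) • v‖ ≤ 977 / 10000 * ‖v‖) ∧ (∀ j k, j ≠ k → dist ((⇑φ ∘ y) j) ((⇑φ ∘ y) i) ≤ 2931 / 1000 → 977 / 2000 ≤ dist ((⇑φ ∘ y) j) ((⇑φ ∘ y) k)) ∧ (∀ j, dist ((⇑φ ∘ y) j) ((⇑φ ∘ y) i) ≤ 2931 / 1000 → ∃ z ∈ Literature.MathematicalPhysics.StatisticalMechanics.barlowStacking 1 (Real.sqrt (2 / 3)) s, dist ((⇑φ ∘ y) j) (g (F z)) ≤ 977 / 8000) ∧ (∀ z ∈ Literature.MathematicalPhysics.StatisticalMechanics.barlowStacking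 1 (Real.sqrt (2 / 3)) s, dist (g (F z)) ((⇑φ ∘ y) i) ≤ 2931 / 1000 → ∃ j, dist ((⇑φ ∘ y) j) (g (F z)) ≤ 977 / 8000) := by
  obtain ⟨s, F, g, hs, hF, hsep, hm1, hm2⟩ := h
  refine ⟨s, F, g.trans φ, hs, hF, ?_, ?_, ?_⟩
  · intro j k hjk hj
    simp only [Function.comp_apply, AffineIsometryEquiv.dist_map] at hj ⊢
    exact hsep j k hjk hj
  · intro j hj
    simp only [Function.comp_apply, AffineIsometryEquiv.dist_map,
      AffineIsometryEquiv.coe_trans] at hj ⊢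
    exact hm1 j hj
  · intro z hz hzi
    simp only [Function.comp_apply, AffineIsometryEquiv.dist_map,
      AffineIsometryEquiv.coe_trans] at hzi ⊢
    exact hm2 z hz hzi

/-- **Rigid-motion invariance.**  For a rigid motion `φ` of `ℝ³`, the site `i` is near₂ in
`φ ∘ y` iff it is near₂ in `y`. [folklore] -/
theorem nearBasin_isometry_comp_iff (φ : EuclideanSpace ℝ (Fin 3) ≃ᵃⁱ[ℝ] EuclideanSpace ℝ (Fin 3)) (y : ι → EuclideanSpace ℝ (Fin 3)) (i : ι) :
    (∃ (s : ℤ → ℤ) (F : EuclideanSpace ℝ (Fin 3) →L[ℝ] EuclideanSpace ℝ (Fin 3)) (g : EuclideanSpace ℝ (Fin 3) ≃ᵃⁱ[ℝ] EuclideanSpace ℝ (Fin 3)), Literature.MathematicalPhysics.StatisticalMechanics.IsHaggSeq s ∧ (∀ v : EuclideanSpace ℝ (Fin 3), ‖F v - (977 / 1000 : ℝ) • v‖ ≤ 977 / 10000 * ‖v‖) ∧ (∀ j k, j ≠ k → dist ((⇑φ ∘ y) j) ((⇑φ ∘ y) i) ≤ 2931 / 1000 → 977 / 2000 ≤ dist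 ((⇑φ ∘ y) j) ((⇑φ ∘ y) k)) ∧ (∀ j, dist ((⇑φ ∘ y) j) ((⇑φ ∘ y) i) ≤ 2931 / 1000 → ∃ z ∈ Literature.MathematicalPhysics.StatisticalMechanics.barlowStacking 1 (Real.sqrt (2 / 3)) s, dist ((⇑φ ∘ y) j) (g (F z)) ≤ 977 / 8000) ∧ (∀ z ∈ Literature.MathematicalPhysics.StatisticalMechanics.barlowStacking 1 (Real.sqrt (2 / 3)) s, dist (g (F z)) ((⇑φ ∘ y) i) ≤ 2931 / 1000 → ∃ j, dist ((⇑φ ∘ y) j) (g (F z)) ≤ 977 / 8000)) ↔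
      (∃ (s : ℤ → ℤ) (F : EuclideanSpace ℝ (Fin 3) →L[ℝ] EuclideanSpace ℝ (Fin 3)) (g : EuclideanSpace ℝ (Fin 3) ≃ᵃⁱ[ℝ] EuclideanSpace ℝ (Fin 3)), Literature.MathematicalPhysics.StatisticalMechanics.IsHaggSeq s ∧ (∀ v : EuclideanSpace ℝ (Fin 3), ‖F v - (977 / 1000 : ℝ) • v‖ ≤ 977 / 10000 * ‖v‖) ∧ (∀ j k, j ≠ k → dist (y j) (y i) ≤ 2931 / 1000 → 977 / 2000 ≤ dist (y j) (y k)) ∧ (∀ j, dist (y j) (y i) ≤ 2931 / 1000 → ∃ z ∈ Literature.MathematicalPhysics.StatisticalMechanics.barlowStacking 1 (Real.sqrt (2 / 3)) s, dist (y j) (g (F z)) ≤ 977 / 8000) ∧ (∀ z ∈ Literature.MathematicalPhysics.StatisticalMechanics.barlowStacking 1 (Real.sqrt (2 / 3)) s, dist (g (F z)) (y i) ≤ 2931 / 1000 → ∃ j, dist (y j) (g (F z)) ≤ 977 / 8000)) := by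
  refine ⟨fun h => ?_, nearBasin_isometry_comp_of φ y i⟩
  have h' := nearBasin_isometry_comp_of φ.symm (⇑φ ∘ y) i h
  have hcomp : (⇑φ.symm ∘ (⇑φ ∘ y)) = y := by
    funext j
    simp
  rwa [hcomp] at h'

/-- **Translation invariance.**  Translating the whole configuration by `t` does not change
the near₂ predicate. [folklore] -/
theorem nearBasin_add_const_comp_iff (t : EuclideanSpace ℝ (Fin 3)) (y : ι → EuclideanSpace ℝ (Fin 3)) (i : ι) :
    (∃ (s : ℤ → ℤ) (F : EuclideanSpace ℝ (Fin 3) →L[ℝ] EuclideanSpace ℝ (Fin 3)) (g : EuclideanSpace ℝ (Fin 3) ≃ᵃⁱ[ℝ] EuclideanSpace ℝ (Fin 3)), Literature.MathematicalPhysics.StatisticalMechanics.IsHaggSeq s ∧ (∀ v : EuclideanSpace ℝ (Fin 3), ‖F v - (977 / 1000 : ℝ) • v‖ ≤ 977 / 10000 * ‖v‖) ∧ (∀ j k, j ≠ k → dist (((fun x : EuclideanSpace ℝ (Fin 3) => x + t) ∘ y) j) (((fun x : EuclideanSpace ℝ (Fin 3) => x + t) ∘ y) i) ≤ 2931 / 1000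 → 977 / 2000 ≤ dist (((fun x : EuclideanSpace ℝ (Fin 3) => x + t) ∘ y) j) (((fun x : EuclideanSpace ℝ (Fin 3) => x + t) ∘ y) k)) ∧ (∀ j, dist (((fun x : EuclideanSpace ℝ (Fin 3) => x + t) ∘ y) j) (((fun x : EuclideanSpace ℝ (Fin 3) => x + t) ∘ y) i) ≤ 2931 / 1000 → ∃ z ∈ Literature.MathematicalPhysics.StatisticalMechanics.barlowStacking 1 (Real.sqrt (2 / 3)) s, dist (((fun x : EuclideanSpace ℝ (Fin 3) => x + t) ∘ y) j) (g (F z)) ≤ 977 / 8000) ∧ (∀ z ∈ Literature.MathematicalPhysics.StatisticalMechanics.barlowStacking 1 (Real.sqrt (2 / 3)) s, dist (g (F z)) (((fun x : EuclideanSpace ℝ (Fin 3) => x + t) ∘ y) i) ≤ 2931 / 1000 → ∃ j, dist (((fun x : EuclideanSpace ℝ (Fin 3) => x + t) ∘ y) j) (g (F z)) ≤ 977 / 8000)) ↔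
      (∃ (s : ℤ → ℤ) (F : EuclideanSpace ℝ (Fin 3) →L[ℝ] EuclideanSpace ℝ (Fin 3)) (g : EuclideanSpace ℝ (Fin 3) ≃ᵃⁱ[ℝ] EuclideanSpace ℝ (Fin 3)), Literature.MathematicalPhysics.StatisticalMechanics.IsHaggSeq s ∧ (∀ v : EuclideanSpace ℝ (Fin 3), ‖F v - (977 / 1000 : ℝ) • v‖ ≤ 977 / 10000 * ‖v‖) ∧ (∀ j k, j ≠ k → dist (y j) (y i) ≤ 2931 / 1000 → 977 / 2000 ≤ dist (y j) (y k)) ∧ (∀ j, dist (y j) (y i) ≤ 2931 / 1000 → ∃ z ∈ Literature.MathematicalPhysics.StatisticalMechanics.barlowStacking 1 (Real.sqrt (2 / 3)) s, dist (y j) (g (F z)) ≤ 977 / 8000) ∧ (∀ z ∈ Literature.MathematicalPhysics.StatisticalMechanics.barlowStacking 1 (Real.sqrt (2 / 3)) s, dist (g (F z)) (y i) ≤ 2931 / 1000 → ∃ j, dist (y j) (g (F z)) ≤ 977 / 8000)) := by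
  have h : (fun x : EuclideanSpace ℝ (Fin 3) => x + t) =
      ⇑(AffineIsometryEquiv.vaddConst ℝ t : EuclideanSpace ℝ (Fin 3) ≃ᵃⁱ[ℝ] EuclideanSpace ℝ (Fin 3)) := by
    funext x
    simp [vadd_eq_add]
  rw [h]
  exact nearBasin_isometry_comp_iff _ y i

/-- **Defect-far-site locality (general form).**  Let `y : ι → ℝ³` be a configuration and
`f : κ → ι` an injective re-indexing whose range contains every site within `357/100` of
`y (f i)`.  Then `f i` is near₂ in `y` iff `i` is near₂ in the sub-configuration `y ∘ f` (same
word, strain and motion): the separation clause only involves sites within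
`2931/1000 + 977/2000 ≤ 357/100` of `y (f i)`, the matching witnesses lie within
`2931/1000 + 977/8000` of it. [folklore] -/
theorem nearBasin_apply_iff_comp (y : ι → EuclideanSpace ℝ (Fin 3)) {f : κ → ι} (hf : Function.Injective f)
    (i : κ) (hS : ∀ k, dist (y k) (y (f i)) ≤ 357 / 100 → k ∈ Set.range f) :
    (∃ (s : ℤ → ℤ) (F : EuclideanSpace ℝ (Fin 3) →L[ℝ] EuclideanSpace ℝ (Fin 3)) (g : EuclideanSpace ℝ (Fin 3) ≃ᵃⁱ[ℝ] EuclideanSpace ℝ (Fin 3)), Literature.MathematicalPhysics.StatisticalMechanics.IsHaggSeq s ∧ (∀ v : EuclideanSpace ℝ (Fin 3), ‖F v - (977 / 1000 : ℝ) • v‖ ≤ 977 / 10000 * ‖v‖) ∧ (∀ j k, j ≠ k → dist (y j) (y (f i)) ≤ 2931 / 1000 → 977 / 2000 ≤ dist (y j) (y k)) ∧ (∀ j, dist (y j) (y (f i)) ≤ 2931 / 1000 → ∃ z ∈ Literature.MathematicalPhysics.StatisticalMechanics.barlowStacking 1 (Real.sqrt (2 / 3)) s, dist (y j) (g (F z))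 ≤ 977 / 8000) ∧ (∀ z ∈ Literature.MathematicalPhysics.StatisticalMechanics.barlowStacking 1 (Real.sqrt (2 / 3)) s, dist (g (F z)) (y (f i)) ≤ 2931 / 1000 → ∃ j, dist (y j) (g (F z)) ≤ 977 / 8000)) ↔
      (∃ (s : ℤ → ℤ) (F : EuclideanSpace ℝ (Fin 3) →L[ℝ] EuclideanSpace ℝ (Fin 3)) (g : EuclideanSpace ℝ (Fin 3) ≃ᵃⁱ[ℝ] EuclideanSpace ℝ (Fin 3)), Literature.MathematicalPhysics.StatisticalMechanics.IsHaggSeq s ∧ (∀ v : EuclideanSpace ℝ (Fin 3), ‖F v - (977 / 1000 : ℝ) • v‖ ≤ 977 / 10000 * ‖v‖) ∧ (∀ j k, j ≠ k → dist ((y ∘ f) j) ((y ∘ f) i) ≤ 2931 / 1000 → 977 / 2000 ≤ dist ((y ∘ f) j) ((y ∘ f) k)) ∧ (∀ j, dist ((y ∘ f) j) ((y ∘ f) i) ≤ 2931 / 1000 → ∃ z ∈ Literature.MathematicalPhysics.StatisticalMechanics.barlowStacking 1 (Real.sqrt (2 / 3)) s, dist ((y ∘ f) j) (g (F z)) ≤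 977 / 8000) ∧ (∀ z ∈ Literature.MathematicalPhysics.StatisticalMechanics.barlowStacking 1 (Real.sqrt (2 / 3)) s, dist (g (F z)) ((y ∘ f) i) ≤ 2931 / 1000 → ∃ j, dist ((y ∘ f) j) (g (F z)) ≤ 977 / 8000)) := by
  constructor
  · rintro ⟨s, F, g, hs, hF, hsep, hm1, hm2⟩
    refine ⟨s, F, g, hs, hF, ?_, ?_, ?_⟩
    · intro j k hjk hj
      exact hsep (f j) (f k) (hf.ne hjk) hj
    · intro j hj
      exact hm1 (f j) hj
    · intro z hz hzi
      have hzi' : dist (g (F z)) (y (f i)) ≤ 2931 / 1000 := hzi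
      obtain ⟨j', hj'⟩ := hm2 z hz hzi'
      have hmem : j' ∈ Set.range f := by
        refine hS j' ?_
        have := dist_triangle (y j') (g (F z)) (y (f i))
        linarith
      obtain ⟨j, rfl⟩ := hmem
      exact ⟨j, hj'⟩
  · rintro ⟨s, F, g, hs, hF, hsep, hm1, hm2⟩
    refine ⟨s, F, g, hs, hF, ?_, ?_, ?_⟩
    · intro j k hjk hj
      have hjmem : j ∈ Set.range f := hS j (by linarith)
      obtain ⟨j₀, rfl⟩ := hjmem
      by_contra hlt
      push Not at hlt
      have hkmem : k ∈ Set.range f := by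
        refine hS k ?_
        have := dist_triangle (y k) (y (f j₀)) (y (f i))
        rw [dist_comm (y k) (y (f j₀))] at this
        linarith
      obtain ⟨k₀, rfl⟩ := hkmem
      have hne : j₀ ≠ k₀ := fun h => hjk (by rw [h])
      have := hsep j₀ k₀ hne hj
      exact absurd this (not_le.2 hlt)
    · intro j hj
      have hjmem : j ∈ Set.range f := hS j (by linarith)
      obtain ⟨j₀, rfl⟩ := hjmem
      exact hm1 j₀ hj
    · intro z hz hzi
      obtain ⟨j, hj⟩ := hm2 z hz hzi
      exact ⟨f j, hj⟩

/-- **Defect-far-site locality (general form, far version).**  Under the same hypotheses,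
`f i` is DEFECT-FAR (not near₂) in `y` iff `i` is defect-far in `y ∘ f`. [folklore] -/
theorem dfar_apply_iff_comp (y : ι → EuclideanSpace ℝ (Fin 3)) {f : κ → ι} (hf : Function.Injective f)
    (i : κ) (hS : ∀ k, dist (y k) (y (f i)) ≤ 357 / 100 → k ∈ Set.range f) :
    (¬ ∃ (s : ℤ → ℤ) (F : EuclideanSpace ℝ (Fin 3) →L[ℝ] EuclideanSpace ℝ (Fin 3)) (g : EuclideanSpace ℝ (Fin 3) ≃ᵃⁱ[ℝ] EuclideanSpace ℝ (Fin 3)), Literature.MathematicalPhysics.StatisticalMechanics.IsHaggSeq s ∧ (∀ v : EuclideanSpace ℝ (Fin 3), ‖F v - (977 / 1000 : ℝ) • v‖ ≤ 977 / 10000 * ‖v‖) ∧ (∀ j k, j ≠ k → dist (y j) (y (f i)) ≤ 2931 / 1000 → 977 / 2000 ≤ dist (y j) (y k)) ∧ (∀ j, dist (y j) (y (f i)) ≤ 2931 / 1000 → ∃ z ∈ Literature.MathematicalPhysics.StatisticalMechanics.barlowStacking 1 (Real.sqrt (2 / 3)) s, dist (y j) (g (F z)) ≤ 977 / 8000) ∧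 (∀ z ∈ Literature.MathematicalPhysics.StatisticalMechanics.barlowStacking 1 (Real.sqrt (2 / 3)) s, dist (g (F z)) (y (f i)) ≤ 2931 / 1000 → ∃ j, dist (y j) (g (F z)) ≤ 977 / 8000)) ↔
      (¬ ∃ (s : ℤ → ℤ) (F : EuclideanSpace ℝ (Fin 3) →L[ℝ] EuclideanSpace ℝ (Fin 3)) (g : EuclideanSpace ℝ (Fin 3) ≃ᵃⁱ[ℝ] EuclideanSpace ℝ (Fin 3)), Literature.MathematicalPhysics.StatisticalMechanics.IsHaggSeq s ∧ (∀ v : EuclideanSpace ℝ (Fin 3), ‖F v - (977 / 1000 : ℝ) • v‖ ≤ 977 / 10000 * ‖v‖) ∧ (∀ j k, j ≠ k → dist ((y ∘ f) j) ((y ∘ f) i) ≤ 2931 / 1000 → 977 / 2000 ≤ dist ((y ∘ f) j) ((y ∘ f) k)) ∧ (∀ j, dist ((y ∘ f) j) ((y ∘ f) i) ≤ 2931 / 1000 → ∃ z ∈ Literature.MathematicalPhysics.StatisticalMechanics.barlowStacking 1 (Real.sqrt (2 / 3)) s, dist ((y ∘ f) j) (g (F z)) ≤ 977 / 8000) ∧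 (∀ z ∈ Literature.MathematicalPhysics.StatisticalMechanics.barlowStacking 1 (Real.sqrt (2 / 3)) s, dist (g (F z)) ((y ∘ f) i) ≤ 2931 / 1000 → ∃ j, dist ((y ∘ f) j) (g (F z)) ≤ 977 / 8000)) :=
  not_congr (nearBasin_apply_iff_comp y hf i hS)

end General

/-! ## `Fin`-indexed forms -/

/-- **Defect-far-site locality** (`Fin`-indexed form, the FAR₂-analogue of
`isChargeFree_sub_iff` / `underCoordinated_sub_iff` / `nearBarlow_sub_iff`): for a
sub-configuration `y ∘ f` (`f : Fin M ↪ Fin N`) of a finite configuration `y : Fin N → ℝ³`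
whose range contains every site within `357/100` of `y (f i)`, the site `f i` is near₂ in `y`
iff `i` is near₂ in `y ∘ f`. [folklore] -/
theorem nearBasin_sub_iff : ∀ (N M : ℕ) (y : Fin N → EuclideanSpace ℝ (Fin 3)) (f : Fin M ↪ Fin N) (i : Fin M), (∀ k : Fin N, dist (y k) (y (f i)) ≤ 357 / 100 → k ∈ Set.range f) → ((∃ (s : ℤ → ℤ) (F : EuclideanSpace ℝ (Fin 3) →L[ℝ] EuclideanSpace ℝ (Fin 3)) (g : EuclideanSpace ℝ (Fin 3) ≃ᵃⁱ[ℝ] EuclideanSpace ℝ (Fin 3)), Literature.MathematicalPhysics.StatisticalMechanics.IsHaggSeq s ∧ (∀ v : EuclideanSpace ℝ (Fin 3), ‖F v - (977 / 1000 : ℝ) • v‖ ≤ 977 / 10000 * ‖v‖) ∧ (∀ j k : Fin N, j ≠ k → dist (y j) (y (f i)) ≤ 2931 / 1000 → 977 / 2000 ≤ dist (y j) (y k)) ∧ (∀ j : Fin N, dist (y j) (y (f i)) ≤ 2931 / 1000 → ∃ z ∈ Literature.MathematicalPhysics.StatisticalMechanics.barlowStacking 1 (Real.sqrt (2 / 3))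 s, dist (y j) (g (F z)) ≤ 977 / 8000) ∧ (∀ z ∈ Literature.MathematicalPhysics.StatisticalMechanics.barlowStacking 1 (Real.sqrt (2 / 3)) s, dist (g (F z)) (y (f i)) ≤ 2931 / 1000 → ∃ j : Fin N, dist (y j) (g (F z)) ≤ 977 / 8000)) ↔ (∃ (s : ℤ → ℤ) (F : EuclideanSpace ℝ (Fin 3) →L[ℝ] EuclideanSpace ℝ (Fin 3)) (g : EuclideanSpace ℝ (Fin 3) ≃ᵃⁱ[ℝ] EuclideanSpace ℝ (Fin 3)), Literature.MathematicalPhysics.StatisticalMechanics.IsHaggSeq s ∧ (∀ v : EuclideanSpace ℝ (Fin 3), ‖F v - (977 / 1000 : ℝ) • v‖ ≤ 977 / 10000 * ‖v‖) ∧ (∀ j k : Fin M, j ≠ k → dist ((y ∘ f) j) ((y ∘ f) i) ≤ 2931 / 1000 → 977 / 2000 ≤ dist ((y ∘ f) j) ((y ∘ f) k)) ∧ (∀ j : Fin M, dist ((y ∘ f) j) ((y ∘ f) i) ≤ 2931 / 1000 → ∃ z ∈ Literature.MathematicalPhysics.StatisticalMechanics.barlowStacking 1 (Real.sqrt (2 /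 3)) s, dist ((y ∘ f) j) (g (F z)) ≤ 977 / 8000) ∧ (∀ z ∈ Literature.MathematicalPhysics.StatisticalMechanics.barlowStacking 1 (Real.sqrt (2 / 3)) s, dist (g (F z)) ((y ∘ f) i) ≤ 2931 / 1000 → ∃ j : Fin M, dist ((y ∘ f) j) (g (F z)) ≤ 977 / 8000))) := by
  intro N M y f i hS
  exact nearBasin_apply_iff_comp y f.injective i hS

/-- **Defect-far-site locality, far version** (`Fin`-indexed form): with every site within
`357/100` of `y (f i)` in the range of `f : Fin M ↪ Fin N`, the site `f i` is DEFECT-FAR (not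
near₂) in `y` iff `i` is defect-far in `y ∘ f` — the predicate counted by
`Nat.card {i // ¬ ∃ s F g, …}` in the stub `stub_defectFarSiteGap`. [folklore] -/
theorem dfar_sub_iff : ∀ (N M : ℕ) (y : Fin N → EuclideanSpace ℝ (Fin 3)) (f : Fin M ↪ Fin N) (i : Fin M), (∀ k : Fin N, dist (y k) (y (f i)) ≤ 357 / 100 → k ∈ Set.range f) → ((¬ ∃ (s : ℤ → ℤ) (F : EuclideanSpace ℝ (Fin 3) →L[ℝ] EuclideanSpace ℝ (Fin 3)) (g : EuclideanSpace ℝ (Fin 3) ≃ᵃⁱ[ℝ] EuclideanSpace ℝ (Fin 3)), Literature.MathematicalPhysics.StatisticalMechanics.IsHaggSeq s ∧ (∀ v : EuclideanSpace ℝ (Fin 3), ‖F v - (977 / 1000 : ℝ) • v‖ ≤ 977 / 10000 * ‖v‖) ∧ (∀ j k : Fin N, j ≠ k → dist (y j) (y (f i)) ≤ 2931 / 1000 → 977 / 2000 ≤ dist (y j) (y k)) ∧ (∀ j : Fin N, dist (y j) (y (f i)) ≤ 2931 / 1000 → ∃ z ∈ Literature.MathematicalPhysics.StatisticalMechanics.barlowStacking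 1 (Real.sqrt (2 / 3)) s, dist (y j) (g (F z)) ≤ 977 / 8000) ∧ (∀ z ∈ Literature.MathematicalPhysics.StatisticalMechanics.barlowStacking 1 (Real.sqrt (2 / 3)) s, dist (g (F z)) (y (f i)) ≤ 2931 / 1000 → ∃ j : Fin N, dist (y j) (g (F z)) ≤ 977 / 8000)) ↔ (¬ ∃ (s : ℤ → ℤ) (F : EuclideanSpace ℝ (Fin 3) →L[ℝ] EuclideanSpace ℝ (Fin 3)) (g : EuclideanSpace ℝ (Fin 3) ≃ᵃⁱ[ℝ] EuclideanSpace ℝ (Fin 3)), Literature.MathematicalPhysics.StatisticalMechanics.IsHaggSeq s ∧ (∀ v : EuclideanSpace ℝ (Fin 3), ‖F v - (977 / 1000 : ℝ) • v‖ ≤ 977 / 10000 * ‖v‖) ∧ (∀ j k : Fin M, j ≠ k → dist ((y ∘ f) j) ((y ∘ f) i) ≤ 2931 / 1000 → 977 / 2000 ≤ dist ((y ∘ f) j) ((y ∘ f) k)) ∧ (∀ j : Fin M, dist ((y ∘ f) j) ((y ∘ f) i) ≤ 2931 / 1000 → ∃ z ∈ Literature.MathematicalPhysics.StatisticalMechanics.barlowStacking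 1 (Real.sqrt (2 / 3)) s, dist ((y ∘ f) j) (g (F z)) ≤ 977 / 8000) ∧ (∀ z ∈ Literature.MathematicalPhysics.StatisticalMechanics.barlowStacking 1 (Real.sqrt (2 / 3)) s, dist (g (F z)) ((y ∘ f) i) ≤ 2931 / 1000 → ∃ j : Fin M, dist ((y ∘ f) j) (g (F z)) ≤ 977 / 8000))) := by
  intro N M y f i hS
  exact dfar_apply_iff_comp y f.injective i hS

end Summit.AtomisticToContinuum.Crystallization.Theorems.PricedLinkCensusTruncatedCensusGap

end
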